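import Summits.FinalStateConjecture.FinalStateConjecture.Theorems.ZeroEnergyKerrOrBombSymplecticDualOfTheBombDefs
import Summits.FinalStateConjecture.FinalStateConjecture.Theorems.ZeroEnergyKerrOrBombStationaryLimitReductionStubMoncriefTransversality
import Literature.Geometry.Lorentzian.IPlusRegular
import HarnessLib

/-!
# Route ZeroEnergyKerrOrBomb · crux `StationaryLimitReduction` — posited objects of the line
# `symplectic-dual-of-the-bomb`, SECOND module (reshape r3 vocabulary; D-0016 `<Route>Defs` convention)

This file carries no mathematics beyond definitions (and definitional read-back lemmas). It is the
vocabulary introduced by reshape r3 of the checked skeleton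
`Cruxes/StationaryLimitReduction/Lines/symplectic_dual_of_the_bomb.lean` (crux stmt-FinalStateConjecture-10021,
`ZeroEnergyKerrOrBomb.StationaryLimitReduction := KerrOrBomb → FinalStateConjecture`; lead
prover-line-stmt-FinalStateConjecture-10021-a1-0) after wave 1 found the r1 currency `SettlesWith`
(first module, p101414) without an honest model (collar charts + exhaustiveness: `reach_of_hasExhaustiveCharts`,
p104896) and stubs 4/5 collapsed by antisymmetric detectors / the global reading of
`HasNoLocalKillingFieldNear` (p104819, p105738):

* `ChartIsAsymptoticallySchwarzschildean` (rate `r⁻²` against the Schwarzschild Kerr–Schild form),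
  `IsKerrChartedWith` (exposed witnesses + asymptotic control of `Θ`) and its projection to `IsKerrCharted`;
* the d.o.c. parts of a stationary decomposition: `docPart`, `docCharted`, `docCertifiedLate`,
  `docCertifiedSlab`, `HasExhaustiveDocCharts`, `IsHorizonNormalised`, and the currency `SettlesDocWith`;
* the naive Kerr–Schild recut: `recutMap`, `recutImage`, `recutBackground`, `recutCharted`,
  `recutInitialSlabs`, `recutCertifiedLate`, `recutCertifiedSlab`, and its covering clauses
  `KerrSchildRecutCovering`;
* `AreSymmDetectorsAt` (symmetric detectors at a germ-KID-free point, over `IsKIDFreeAt` of p105738).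

Everything is a definition over EXISTING declarations; nothing restates a route item; the module does not
import the route file `Theses.ZeroEnergyKerrOrBomb`.
-/

-- every `Summit.FinalStateConjecture.FinalStateConjecture.…` name repeats the summit = sub-problem segment (D-0017 layout)
set_option linter.dupNamespace false

noncomputable section

open scoped Manifold ContDiff Topology BigOperators
open Set Filter Bundle MeasureTheory Literature.Geometry.Lorentzian

namespace Summit.FinalStateConjecture.FinalStateConjecture.Theorems.SymplecticDualOfTheBomb

open Summit.FinalStateConjecture.FinalStateConjecture.Theorems.OneLockedExplosion

/-! ## §0′ Vocabulary of reshape r3 (definitions; nothing is asserted here) -/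

/-- The adapted chart `A` is **asymptotically Schwarzschildean at rate `r⁻²`**: far out its components
differ from the Schwarzschild Kerr–Schild form `Kerr.bilin M 0` of some mass `M` by `≤ C / r²`
(stationary vacuum ends are Schwarzschild + `O(r⁻²)` in adapted harmonic-type coordinates — Beig–Simon,
Kennefick–Ó Murchadha; Kerr itself: `Kerr.bilin M a − Kerr.bilin M 0 = O(Ma/r²)`). It is the RATE the
chartTransfer worker (D2) showed necessary for a bounded tilt of the Kerr identification: the rate-free
clause (1) of `ChartIsAsymptoticallyCartesian` admits the re-foliation `x⁰ = t* − χ(r)·2M log(r/2M − 1)`.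
[cite: ChruscielCosta2008, §2.1] -/
def ChartIsAsymptoticallySchwarzschildean {𝓑 : StationaryAFBlackHole.{0}} (A : 𝓑.AdaptedChart) : Prop :=
  ∃ M C R₀ : ℝ, ∀ x : A.domain, R₀ ≤ A.radius x.1 →
    ‖A.bilin x.1 - Kerr.bilin M 0 x.1‖ ≤ C / (A.radius x.1) ^ 2

/-- **`T`-equivariant, horizon-regular, asymptotically controlled Kerr identification with exposed
witnesses** (r3 form of `IsKerrCharted`, p101414): the clauses of `IsKerrCharted 𝓑 A` for the given
`(M, a, c, r₀, Θ)`, plus ASYMPTOTIC CONTROL of `Θ` on the far exterior `{r ≥ r₊ + 1}`: bounded tilt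
`|(Θ u)⁰ − c u⁰| ≤ L`, bounded radial distortion `|r_A(Θ u) − r(u)| ≤ L`, and bounded derivatives of orders
`1 ≤ n ≤ 3` (an isometry between asymptotically Schwarzschildean charts is asymptotically a rigid motion).
These are what the chart transfer needs to move growing certified radii and late regions through `Θ`
(chartTransfer worker, D2). [cite: ChruscielCosta2008, Thm. 1.3] -/
def IsKerrChartedWith (𝓑 : StationaryAFBlackHole.{0}) (A : 𝓑.AdaptedChart) (M a c r₀ : ℝ)
    (Θ : E4 → E4) : Prop :=
  Kerr.IsSubextremal M a ∧ 0 < c ∧ Kerr.rMinus M a < r₀ ∧ r₀ < Kerr.rPlus M a ∧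
    ContDiffOn ℝ ∞ Θ (Kerr.region a r₀ : Set E4) ∧
    Set.InjOn Θ (Kerr.region a r₀ : Set E4) ∧
    Set.MapsTo Θ (Kerr.region a r₀ : Set E4) (A.domain : Set E4) ∧
    (∀ x ∈ (Kerr.region a r₀ : Set E4), ∀ s : ℝ,
      Θ (x + s • E4.basisVector 0) = Θ x + (c * s) • E4.basisVector 0) ∧
    (∀ x ∈ (Kerr.exterior M a : Set E4), ∀ v w : E4,
      A.bilin (Θ x) (fderiv ℝ Θ x v) (fderiv ℝ Θ x w) = Kerr.bilin M a x v w) ∧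
    Θ '' (Kerr.exterior M a : Set E4) = {u : E4 | ∃ h : u ∈ A.domain, A.toFun ⟨u, h⟩ ∈ 𝓑.doc} ∧
    ∃ L : ℝ, ∀ u ∈ (Kerr.exterior M a : Set E4), Kerr.rPlus M a + 1 ≤ Kerr.radius a u →
      |Θ u 0 - c * u 0| ≤ L ∧ |A.radius (Θ u) - Kerr.radius a u| ≤ L ∧
        ∀ n : ℕ, 1 ≤ n → n ≤ 3 → ‖iteratedFDeriv ℝ n Θ u‖ ≤ L

/-- The exposed form gives back `IsKerrCharted` (p101414). [folklore] -/
theorem IsKerrChartedWith.isKerrCharted {𝓑 : StationaryAFBlackHole.{0}} {A : 𝓑.AdaptedChart}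
    {M a c r₀ : ℝ} {Θ : E4 → E4} (h : IsKerrChartedWith 𝓑 A M a c r₀ Θ) : IsKerrCharted 𝓑 A := by
  obtain ⟨h1, h2, h3, h4, h5, h6, h7, h8, h9, h10, -⟩ := h
  exact ⟨M, a, c, r₀, Θ, h1, h2, h3, h4, h5, h6, h7, h8, h9, h10⟩

section DocParts

variable {𝓢 : Spacetime.{0} 4} {O : Set 𝓢.carrier} {k : ℕ}

/-- **The d.o.c. part of the (moved) adapted chart domain of hole `i`**: points of the background domain
whose rest-frame preimage is charted by `Aᵢ` INTO the domain of outer communications of `𝓑ᵢ` (the collar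
behind `𝓗⁺` is excluded). Under `IsKerrCharted`'s anchor it is the motion-image of `Θᵢ '' Kerr.exterior`.
[cite: ChruscielCosta2008, (2.2)] -/
def docPart (d : StationaryFinalStateDecomposition 𝓢 O k) (i : Fin d.N) : Set (d.background i).domain :=
  {x | ∃ h : poincareInv (d.motion i).1 (d.motion i).2 x.1 ∈ (d.adapted i).domain,
    (d.adapted i).toFun ⟨_, h⟩ ∈ (d.hole i).doc}

/-- The **d.o.c.-charted late region**: radiation zone plus the late images of the d.o.c. parts of the
hole charts (r3 replacement of `d.charted` in the exterior clause). [cite: DafermosLuk2017, §1.2.1] -/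
def docCharted (d : StationaryFinalStateDecomposition 𝓢 O k) : Set 𝓢.carrier :=
  d.toOver.radiationZone ∪
    ⋃ i, d.toOver.chart i '' ((d.background i).lateRegion d.toOver.τ₀ ∩ docPart d i)

/-- The **d.o.c.-certified late region after chart time `τ₁`** (shape of `certifiedLate`, hole parts
intersected with the d.o.c. parts). [cite: DafermosLuk2017, Conjecture 1 (b)] -/
def docCertifiedLate (d : StationaryFinalStateDecomposition 𝓢 O k) (R : Fin d.N → ℝ → ℝ) (τ₁ : ℝ) :
    Set 𝓢.carrier :=
  d.toOver.flatChart '' (Minkowski.backgroundOn d.toOver.flatDomain).lateRegion τ₁ ∪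
    ⋃ i, d.toOver.chart i '' ({x | τ₁ < (d.background i).time x.1 ∧
      (d.background i).radius x.1 ≤ R i ((d.background i).time x.1)} ∩ docPart d i)

/-- The **d.o.c.-certified slab at chart time `τ₁`** (shape of `certifiedSlab`, hole parts intersected
with the d.o.c. parts). [cite: DafermosLuk2017, Conjecture 1 (b)] -/
def docCertifiedSlab (d : StationaryFinalStateDecomposition 𝓢 O k) (R : Fin d.N → ℝ → ℝ) (τ₁ : ℝ) :
    Set 𝓢.carrier :=
  d.toOver.flatChart '' (Minkowski.backgroundOn d.toOver.flatDomain).timeSlab τ₁ ∪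
    ⋃ i, d.toOver.chart i '' ((d.background i).truncTimeSlab (R i τ₁) τ₁ ∩ docPart d i)

/-- **The charts exhaust `O` through their d.o.c. parts** (r3 replacement of `HasExhaustiveCharts`):
monotone growing near-zone radii `Rᵢ` with (i) `C^k` convergence on the growing truncated slabs
(collar included — regularity is honest there) and (ii) for EVERY chart time `τ₁ > τ₀`, every point of
`O` outside the d.o.c.-certified late region lies in the causal past of the d.o.c.-certified slab.
[cite: DafermosLuk2017, Conjecture 1 (b)–(c)] -/
def HasExhaustiveDocCharts (d : StationaryFinalStateDecomposition 𝓢 O k) : Prop :=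
  ∃ R : Fin d.N → ℝ → ℝ,
    (∀ i, Tendsto (fun τ ↦ 𝓢.truncDeviationCk (d.background i) (d.toOver.chart i) k (R i τ) τ)
      atTop (𝓝 0)) ∧
    (∀ i, Monotone (R i)) ∧
    ∀ τ₁ : ℝ, d.toOver.τ₀ < τ₁ →
      O \ docCertifiedLate d R τ₁ ⊆ 𝓢.metric.causalPast 𝓢.timeOrientation (docCertifiedSlab d R τ₁)

/-- **Horizon normalisation**: every late d.o.c.-part chart point reaches the radiation zone arbitrarily
late (it lies outside the true black hole), i.e. the `r → r₊` ends of the hole charts ARE the event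
horizons (chartTransfer worker, D3 β; honest decompositions can be normalised so). [cite: DafermosLuk2017, Conjecture 1 (b)] -/
def IsHorizonNormalised (d : StationaryFinalStateDecomposition 𝓢 O k) : Prop :=
  ∀ i, ∀ x ∈ (d.background i).lateRegion d.toOver.τ₀ ∩ docPart d i, ∀ σ₀ : ℝ, ∃ σ : ℝ, σ₀ ≤ σ ∧
    d.toOver.chart i x ∈ 𝓢.metric.causalPast 𝓢.timeOrientation
      (d.toOver.flatChart '' (Minkowski.backgroundOn d.toOver.flatDomain).timeSlab σ)

end DocParts

/-- **"Every MGHD of `D` settles down, in the d.o.c. sense, to regular stationary vacuum holes with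
property `Q`"** (r3 replacement of `SettlesWith`, p101414, after D1): complete `𝓘⁺`; a `C²` stationary
decomposition `d` whose exterior `O = J⁺(ιX) ∩ I⁻(docCharted d)` and exhaustiveness are built from the
d.o.c. parts of the charts, horizon-normalised; adapted hole charts covering `𝓗⁺` (collar, for
regularity), asymptotically Cartesian immersions with spacelike leaves reaching `i⁰` AND asymptotically
Schwarzschildean at rate `r⁻²`; holes in `KerrOrBomb`'s telescope, `I⁺`-regular, with property `Q`.
[cite: DafermosLuk2017, §1.2.1] -/
def SettlesDocWith (Q : StationaryAFBlackHole.{0} → Prop) (X : Type) [TopologicalSpace X]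
    [ChartedSpace E3 X] [IsManifold (𝓡 3) ∞ X] [T2Space X] [SecondCountableTopology X]
    [ConnectedSpace X] (D : InitialDataSet (𝓡 3) X) : Prop :=
  ∀ 𝒟 : VacuumCauchyDevelopment D, 𝒟.IsMaximal →
    Summit.FinalStateConjecture.HasCompleteNullInfinity 𝒟.toCauchyDevelopment ∧
      ∃ (O : Set 𝒟.carrier) (d : StationaryFinalStateDecomposition 𝒟.toSpacetime O 2),
        O = Summit.FinalStateConjecture.exteriorOf 𝒟.toCauchyDevelopment (docCharted d) ∧
          HasExhaustiveDocCharts d ∧ IsHorizonNormalised d ∧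
            ∀ i, (d.hole i).horizon ⊆ Set.range (d.adapted i).toFun ∧
              ChartIsAsymptoticallyCartesian (d.adapted i) ∧
                ChartIsAsymptoticallySchwarzschildean (d.adapted i) ∧
                  InTelescope (d.hole i) ∧ (d.hole i).IsIPlusRegular ∧ Q (d.hole i)

section Recut

variable {𝓢 : Spacetime.{0} 4} {O : Set 𝓢.carrier} {k : ℕ}

/-- The Kerr identification `Θ` conjugated by the motion `(Λ, c₀)`: `x ↦ Λ Θ(Λ⁻¹(x − c₀)) + c₀`
(the map by which the late hole chart is re-adapted to boosted Kerr–Schild coordinates). [folklore] -/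
def recutMap (Λ : lorentzGroup) (c₀ : E4) (Θ : E4 → E4) : E4 → E4 :=
  fun x ↦ (Λ : E4 ≃L[ℝ] E4) (Θ (poincareInv Λ c₀ x)) + c₀

/-- Image under the RECUT chart of hole `i` (`ψᵢ ∘ recutMap`) of a set of boosted Kerr–Schild
coordinate points `S ⊆ E4`: stated through the old chart (no dependent plumbing). [folklore] -/
def recutImage (d : StationaryFinalStateDecomposition 𝓢 O k) (Θ : Fin d.N → E4 → E4) (i : Fin d.N)
    (S : Set E4) : Set 𝓢.carrier :=
  d.toOver.chart i '' {y | (y : E4) ∈ recutMap (d.motion i).1 (d.motion i).2 (Θ i) '' S}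

/-- The boosted Kerr–Schild background of hole `i` for parameters `(Mᵢ, aᵢ)` and the motions of `d`.
[cite: DafermosLuk2017, §1.2.1] -/
def recutBackground (d : StationaryFinalStateDecomposition 𝓢 O k) (M a : Fin d.N → ℝ) (i : Fin d.N) :
    ModelBackground :=
  boostedKerrBackground (d.motion i).1 (d.motion i).2 (M i) (a i)

/-- Charted late region of the recut decomposition with late time `τ₀'`: radiation zone after `τ₀'`
plus the recut images of the boosted Kerr–Schild late regions. [cite: DafermosLuk2017, §1.2.1] -/
def recutCharted (d : StationaryFinalStateDecomposition 𝓢 O k) (M a : Fin d.N → ℝ)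
    (Θ : Fin d.N → E4 → E4) (τ₀' : ℝ) : Set 𝓢.carrier :=
  d.toOver.flatChart '' (Minkowski.backgroundOn d.toOver.flatDomain).lateRegion τ₀' ∪
    ⋃ i, recutImage d Θ i (Subtype.val '' (recutBackground d M a i).lateRegion τ₀')

/-- Initial slabs of the recut decomposition at late time `τ₀'`. [cite: DafermosLuk2017, Conjecture 1 (b)] -/
def recutInitialSlabs (d : StationaryFinalStateDecomposition 𝓢 O k) (M a : Fin d.N → ℝ)
    (Θ : Fin d.N → E4 → E4) (τ₀' : ℝ) : Set 𝓢.carrier :=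
  d.toOver.flatChart '' (Minkowski.backgroundOn d.toOver.flatDomain).timeSlab τ₀' ∪
    ⋃ i, recutImage d Θ i (Subtype.val '' (recutBackground d M a i).timeSlab τ₀')

/-- Certified late region of the recut decomposition after `τ₁` for growing radii `R'`.
[cite: DafermosLuk2017, Conjecture 1 (b)] -/
def recutCertifiedLate (d : StationaryFinalStateDecomposition 𝓢 O k) (M a : Fin d.N → ℝ)
    (Θ : Fin d.N → E4 → E4) (R' : Fin d.N → ℝ → ℝ) (τ₁ : ℝ) : Set 𝓢.carrier :=
  d.toOver.flatChart '' (Minkowski.backgroundOn d.toOver.flatDomain).lateRegion τ₁ ∪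
    ⋃ i, recutImage d Θ i (Subtype.val '' {x : (recutBackground d M a i).domain |
      τ₁ < (recutBackground d M a i).time x.1 ∧
        (recutBackground d M a i).radius x.1 ≤ R' i ((recutBackground d M a i).time x.1)})

/-- Certified slab of the recut decomposition at `τ₁` for radii `R'`. [cite: DafermosLuk2017, Conjecture 1 (b)] -/
def recutCertifiedSlab (d : StationaryFinalStateDecomposition 𝓢 O k) (M a : Fin d.N → ℝ)
    (Θ : Fin d.N → E4 → E4) (R' : Fin d.N → ℝ → ℝ) (τ₁ : ℝ) : Set 𝓢.carrier :=
  d.toOver.flatChart '' (Minkowski.backgroundOn d.toOver.flatDomain).timeSlab τ₁ ∪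
    ⋃ i, recutImage d Θ i (Subtype.val '' (recutBackground d M a i).truncTimeSlab (R' i τ₁) τ₁)

end Recut

/-- **The causal covering clauses of the naive Kerr–Schild recut** (conclusion of the new stub
`stub_recutCovering`, hypothesis of `stub_chartTransfer`; chartTransfer worker D3 + growing radii): for a
vacuum Cauchy development `𝒟`, a stationary decomposition `d` of `O` and Kerr identifications `Θᵢ`, there
are a late time `τ₀' ≥ τ₀` and growing radii `R'ᵢ → ∞` such that, for the recut charts `ψᵢ ∘ recutMap Θᵢ`
on the boosted Kerr–Schild exteriors with the flat chart kept: (i) `C²` convergence to boosted Kerr on the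
growing truncated Kerr–Schild slabs; (init) the part of `O' := exteriorOf 𝒟 (recutCharted τ₀')` not
covered by the recut late images lies in `J⁻` of the recut initial slabs; (ii) for EVERY `τ₁ > τ₀'`, the
part of `O'` outside the recut certified late region lies in `J⁻` of the recut certified slab.
[cite: DafermosLuk2017, Conjecture 1 (b)–(c)] -/
def KerrSchildRecutCovering {X : Type} [TopologicalSpace X] [ChartedSpace E3 X] [IsManifold (𝓡 3) ∞ X]
    [ConnectedSpace X] {D : InitialDataSet (𝓡 3) X} (𝒟 : VacuumCauchyDevelopment D)
    {O : Set 𝒟.carrier} (d : StationaryFinalStateDecomposition 𝒟.toSpacetime O 2)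
    (M a : Fin d.N → ℝ) (Θ : Fin d.N → E4 → E4) : Prop :=
  ∀ hmaps : ∀ i, Set.MapsTo (recutMap (d.motion i).1 (d.motion i).2 (Θ i))
      ((recutBackground d M a i).domain : Set E4) ((d.background i).domain : Set E4),
    ∃ (τ₀' : ℝ) (R' : Fin d.N → ℝ → ℝ), d.toOver.τ₀ ≤ τ₀' ∧
      (∀ i, Tendsto (R' i) atTop atTop) ∧
      (∀ i, Tendsto (fun τ ↦ 𝒟.toSpacetime.truncDeviationCk (recutBackground d M a i)
        (fun y ↦ d.toOver.chart i ⟨recutMap (d.motion i).1 (d.motion i).2 (Θ i) y.1, hmaps i y.2⟩)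
        2 (R' i τ) τ) atTop (𝓝 0)) ∧
      Summit.FinalStateConjecture.exteriorOf 𝒟.toCauchyDevelopment (recutCharted d M a Θ τ₀') \
          recutCharted d M a Θ τ₀' ⊆
        𝒟.metric.causalPast 𝒟.timeOrientation (recutInitialSlabs d M a Θ τ₀') ∧
      ∀ τ₁ : ℝ, τ₀' < τ₁ →
        Summit.FinalStateConjecture.exteriorOf 𝒟.toCauchyDevelopment (recutCharted d M a Θ τ₀') \
            recutCertifiedLate d M a Θ R' τ₁ ⊆
          𝒟.metric.causalPast 𝒟.timeOrientation (recutCertifiedSlab d M a Θ R' τ₁)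

section Slice

variable {X : Type} [TopologicalSpace X] [ChartedSpace E3 X] [IsManifold (𝓡 3) ∞ X]
  [T2Space X] [SecondCountableTopology X] [ConnectedSpace X] {D : InitialDataSet (𝓡 3) X}

/-- **Symmetric detectors at a germ-KID-free point** (r3 repair of `AreDetectorsAt`, after the
antisymmetric collapse of stubs 4/5 found by wave 1, p104819/p105738): the detectors are SYMMETRIC
bilinear-form fields, `x₀` carries no local Killing germ (`IsKIDFreeAt`, connected neighbourhoods), and
`AreDetectorsAt` holds. [folklore] -/
def AreSymmDetectorsAt (𝒟 : VacuumCauchyDevelopment D) (x₀ : X) {k : ℕ} (A B : Fin k → BilinField X) :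
    Prop :=
  (∀ j x (v w : TangentSpace (𝓡 3) x), A j x v w = A j x w v ∧ B j x v w = B j x w v) ∧
    IsKIDFreeAt 𝒟 x₀ ∧ AreDetectorsAt 𝒟 x₀ A B

end Slice

/-- Read-back of `SettlesDocWith` (definitional). Registration device of this module (as `settlesWith_iff`
of the first module). [folklore] -/
theorem settlesDocWith_iff : ∀ (Q : StationaryAFBlackHole.{0} → Prop) (X : Type) [TopologicalSpace X] [ChartedSpace E3 X] [IsManifold (𝓡 3) ∞ X] [T2Space X] [SecondCountableTopology X] [ConnectedSpace X] (D : InitialDataSet (𝓡 3) X), SettlesDocWith Q X D ↔ ∀ 𝒟 : VacuumCauchyDevelopment D, 𝒟.IsMaximal → Summit.FinalStateConjecture.HasCompleteNullInfinity 𝒟.toCauchyDevelopment ∧ ∃ (O : Set 𝒟.carrier) (d : StationaryFinalStateDecomposition 𝒟.toSpacetime O 2), O = Summit.FinalStateConjecture.exteriorOf 𝒟.toCauchyDevelopment (docCharted d) ∧ HasExhaustiveDocCharts d ∧ IsHorizonNormalised d ∧ ∀ i, (d.hole i).horizon ⊆ Set.range (d.adapted i).toFun ∧ ChartIsAsymptoticallyCartesian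 (d.adapted i) ∧ ChartIsAsymptoticallySchwarzschildean (d.adapted i) ∧ InTelescope (d.hole i) ∧ (d.hole i).IsIPlusRegular ∧ Q (d.hole i) :=
  fun _ _ _ _ _ _ _ _ _ ↦ Iff.rfl

/-- `SettlesDocWith` is monotone in the hole property. [folklore] -/
theorem settlesDocWith_mono {Q Q' : StationaryAFBlackHole.{0} → Prop} {X : Type} [TopologicalSpace X]
    [ChartedSpace E3 X] [IsManifold (𝓡 3) ∞ X] [T2Space X] [SecondCountableTopology X]
    [ConnectedSpace X] {D : InitialDataSet (𝓡 3) X} (h : SettlesDocWith Q X D) (hQ : ∀ 𝓑, Q 𝓑 → Q' 𝓑) :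
    SettlesDocWith Q' X D := by
  intro 𝒟 h𝒟
  obtain ⟨hcni, O, d, hO, hex, hnorm, hholes⟩ := h 𝒟 h𝒟
  exact ⟨hcni, O, d, hO, hex, hnorm, fun i ↦ ⟨(hholes i).1, (hholes i).2.1, (hholes i).2.2.1,
    (hholes i).2.2.2.1, (hholes i).2.2.2.2.1, hQ _ (hholes i).2.2.2.2.2⟩⟩

end Summit.FinalStateConjecture.FinalStateConjecture.Theorems.SymplecticDualOfTheBomb

end
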